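import Summits.Ventures.LatticeQCDFlow.Scoring.U1TorusWilsonLoops
import HarnessLib

/-!
# Polyakov-loop correlators of the 2-d `U(1)` torus as boundaries of column strips

HONEST FRAMING: exact (Metropolis-corrected) sampling algorithms for lattice gauge theory;
figures of merit are autocorrelation/cost numbers at stated couplings and volumes; no
continuum-physics claim.

Venture `LatticeQCDFlow` (cell pub-lqcd), sub-topic `Scoring`; FANOUT row 5 (`s0-sun-a`), GEN-8.
NEW WORK of the cell (placement rule).  `Scoring/U1TorusWilsonLoops.lean` computes
`⟨cos θ(∂A)⟩_{L₁×L₂,β}` for every set `A` of plaquettes of the torus (incidence `torusInc e` of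
`Scoring/U1TorusCharacterFormula.lean`).  For the STRIP `A = C × Fin L₂` over a set `C` of columns
the horizontal links cancel around the periodic direction and `∂A` is a difference of POLYAKOV LOOPS
(the vertical lines winding around direction 2):

* `boundaryChain_strip` — `(∂(C × Fin L₂))_l = 0` on horizontal links and `= 𝟙_C(i − 1) − 𝟙_C(i)` on
  the vertical link leaving site `(i, b)`; for `C = {x₀, …, x₀ + R − 1}` this is the chain
  `P(x₀ + R) − P(x₀)` of two Polyakov loops at distance `R`;
* **`torus_u1WilsonExpect_cos_polyakovPair`** — hence, with `a = #C · L₂`,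
  `⟨cos(θ_{P'} − θ_P)⟩_{L₁×L₂,β} = Σ_k I_{|k|}^{V−a}(I_{|k−1|}^a + I_{|k+1|}^a)/2 / Σ_k I_{|k|}^V` — the
  `polyakov_2pt` column of the cell's X02 oracle (row 5 ORACLE-TABLE), depending on the pair only
  through the enclosed area `R·L₂`.

Elementary; nothing is cited.
-/

noncomputable section

open scoped Nat
open Real MeasureTheory Set Finset Literature.Analysis.FunctionSpaces

namespace Summit.Ventures.LatticeQCDFlow.Scoring

section Torus

variable {L₁ L₂ : ℕ} [NeZero L₁] [NeZero L₂] {n : ℕ}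
  (e : Fin 2 × (Fin L₁ × Fin L₂) ≃ Fin (n + 1)) (C : Finset (Fin L₁))

/-- The strip of plaquettes over the columns `C`. -/
def strip : Finset (Fin L₁ × Fin L₂) := univ.filter fun x => x.1 ∈ C

/-- The Polyakov-pair chain of the column set `C`: zero on horizontal links, `𝟙_C(i − 1) − 𝟙_C(i)`
on the vertical link at site `(i, b)`. -/
def polyakovChain (l : Fin (n + 1)) : ℤ :=
  if (e.symm l).1 = 0 then 0
  else (if (e.symm l).2.1 - 1 ∈ C then 1 else 0) - (if (e.symm l).2.1 ∈ C then 1 else 0)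

/-- **The boundary of a column strip is a pair of Polyakov-loop chains**: horizontal links cancel
around the periodic direction. -/
theorem boundaryChain_strip (l : Fin (n + 1)) :
    boundaryChain (torusInc e) (strip C) l = polyakovChain e C l := by
  unfold boundaryChain polyakovChain torusInc strip
  generalize e.symm l = dy
  obtain ⟨d, y⟩ := dy
  by_cases hd : d = 0
  · -- horizontal link: `Σ_{x ∈ strip} ([y = x] − [y = (x.1, x.2 + 1)]) = 𝟙_C(y.1) − 𝟙_C(y.1) = 0`
    simp only [hd, if_true]
    rw [Finset.sum_sub_distrib]
    have h1 : (∑ x ∈ univ.filter (fun x : Fin L₁ × Fin L₂ => x.1 ∈ C), if y = x then (1 : ℤ) else 0) =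
        if y.1 ∈ C then 1 else 0 := by
      rw [Finset.sum_ite_eq]
      simp only [Finset.mem_filter, Finset.mem_univ, true_and]
    have h2 : (∑ x ∈ univ.filter (fun x : Fin L₁ × Fin L₂ => x.1 ∈ C),
        if y = (x.1, x.2 + 1) then (1 : ℤ) else 0) = if y.1 ∈ C then 1 else 0 := by
      have hcongr : ∀ x : Fin L₁ × Fin L₂, (y = (x.1, x.2 + 1)) ↔ ((y.1, y.2 - 1) = x) := by
        intro x
        constructor
        · intro h; rw [h]; simp
        · intro h; rw [← h]; simp
      simp_rw [hcongr]
      rw [Finset.sum_ite_eq]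
      simp only [Finset.mem_filter, Finset.mem_univ, true_and]
    rw [h1, h2, sub_self]
  · -- vertical link: `Σ_{x ∈ strip} ([y = (x.1 + 1, x.2)] − [y = x]) = 𝟙_C(y.1 − 1) − 𝟙_C(y.1)`
    simp only [hd, if_false]
    rw [Finset.sum_sub_distrib]
    have h1 : (∑ x ∈ univ.filter (fun x : Fin L₁ × Fin L₂ => x.1 ∈ C),
        if y = (x.1 + 1, x.2) then (1 : ℤ) else 0) = if y.1 - 1 ∈ C then 1 else 0 := by
      have hcongr : ∀ x : Fin L₁ × Fin L₂, (y = (x.1 + 1, x.2)) ↔ ((y.1 - 1, y.2) = x) := by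
        intro x
        constructor
        · intro h; rw [h]; simp
        · intro h; rw [← h]; simp
      simp_rw [hcongr]
      rw [Finset.sum_ite_eq]
      simp only [Finset.mem_filter, Finset.mem_univ, true_and]
    have h2 : (∑ x ∈ univ.filter (fun x : Fin L₁ × Fin L₂ => x.1 ∈ C), if y = x then (1 : ℤ) else 0) =
        if y.1 ∈ C then 1 else 0 := by
      rw [Finset.sum_ite_eq]
      simp only [Finset.mem_filter, Finset.mem_univ, true_and]
    rw [h1, h2]

omit [NeZero L₁] [NeZero L₂] in
/-- The strip over `C` has `#C · L₂` plaquettes. -/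
theorem card_strip : (strip C : Finset (Fin L₁ × Fin L₂)).card = C.card * L₂ := by
  have h : (strip C : Finset (Fin L₁ × Fin L₂)) = C ×ˢ (univ : Finset (Fin L₂)) := by
    ext x; simp [strip, Finset.mem_product]
  rw [h, Finset.card_product, Finset.card_univ, Fintype.card_fin]

/-- **POLYAKOV-LOOP CORRELATORS OF THE 2-d `U(1)` TORUS.**  For every `L₁, L₂ ≥ 1`, real `β` and set
`C` of columns, the pair of Polyakov loops bounding the strip over `C` has
`⟨cos θ(polyakovChain C)⟩_{L₁×L₂,β} = Σ_k I_{|k|}^{V−a}(I_{|k−1|}^a + I_{|k+1|}^a)/2 / Σ_k I_{|k|}^V`,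
`a = #C·L₂`, `V = L₁L₂`: the correlator of two Polyakov loops at distance `R` (`C` = the `R` columns
between them) depends only on the enclosed area `R·L₂`. -/
theorem torus_u1WilsonExpect_cos_polyakovPair (β : ℝ) :
    u1WilsonExpect univ (torusInc e) (fun _ => β)
        (fun θ => Real.cos (∑ l, (polyakovChain e C l : ℝ) * θ l)) =
      (∑' k : ℤ, besselI k.natAbs β ^ (L₁ * L₂ - C.card * L₂) *
          ((besselI (k - 1).natAbs β ^ (C.card * L₂) + besselI (k + 1).natAbs β ^ (C.card * L₂)) / 2)) /
        ∑' k : ℤ, besselI k.natAbs β ^ (L₁ * L₂) := by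
  have hfun : (fun θ : Fin (n + 1) → ℝ => Real.cos (∑ l, (polyakovChain e C l : ℝ) * θ l)) =
      fun θ => Real.cos (∑ l, (boundaryChain (torusInc e) (strip C) l : ℝ) * θ l) := by
    funext θ; simp_rw [boundaryChain_strip e C]
  rw [hfun, torus_u1WilsonExpect_cos_boundary, card_strip]

end Torus

end Summit.Ventures.LatticeQCDFlow.Scoring
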